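import Summits.Ventures.PercRepro.ExcessOneDownSet

/-!
# Theorem (MA): a non-monotone labelling of a tight complex trace is «tight minus one member»

Setting of `ExcessOneDownSet` (proofs/MINE1-theoremS.md, Addendum 27): `F` has Marica–Schönheim
excess one, `{r} ∈ F`, `∅ ∉ F`, the trace `P = proj r F` is tight and contains every singleton.
`F₀ = part0 r F`, `F₁ = partr r F`, `K = F₀ ∩ F₁`, `Y = diffsY r F`. The labelling is *monotone*
when `F₁` is a down-set and `F₀` an up-set of the complex `P`.

Theorem (YD) (`mem_diffsY_of_subset`) makes the two completions immediate:

* every subset `x` of an `r`-lifted member completes `F` (`sdiff_mem_diffsY_of_subset_partr`: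
  `x \ s ∈ Y` for all `s ∈ F₀`), so `F ∪ {insert r x}` is tight when `x` is a partnerless face
  below an `r`-lifted member (`tight_insert_of_subset_partr`), and then `x` is the only partnerless
  member (`eq_of_partnerless_of_tight_insert`, Lemma B);
* at a `(K, P₁)` cover `(k, insert b k)` the family `F ∪ {insert b k}` is tight
  (`tight_insert_of_partner_cover`), so every member avoiding `r` has its `r`-partner
  (`mem_partr_of_mem_part0_of_tight_insert`, Lemma B).

**Theorem (MA)** (`monotone_or_completed`): the labelling is monotone, or `F₀ ⊆ F₁`, or there is a
unique partnerless member `x`, `F ∪ {insert r x}` is tight and `x` completes `F`. In particular a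
non-monotone labelling has `|P₀| ≤ 1` and every partnerless member completes `F` — the two
statements of Addendum 23 §4 (MA), now without any restriction on the witness direction.
-/

namespace PercRepro.MSTight

open Finset
open scoped FinsetFamily

variable {α : Type*} [DecidableEq α] [Fintype α]

section MonotoneOrCompleted

variable {F : Finset (Finset α)} {r : α}

/-- **Completion.** Every subset `x` of an `r`-lifted member `t` completes `F`: `x \ s ∈ Y` for
every `s ∈ F₀` (`x \ s ⊆ t \ s ∈ Y` and `Y` is a down-set). -/
theorem sdiff_mem_diffsY_of_subset_partr (hF : (F \\ F).card = F.card + 1)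
    (hP : Tight (proj r F)) (hr : ({r} : Finset α) ∈ F) (hE : (∅ : Finset α) ∉ F)
    (hsing : ∀ a, a ≠ r → ({a} : Finset α) ∈ proj r F) {t : Finset α} (ht : t ∈ partr r F)
    {x : Finset α} (hxt : x ⊆ t) {s : Finset α} (hs : s ∈ part0 r F) : x \ s ∈ diffsY r F :=
  mem_diffsY_of_subset hF hP hr hE hsing (sdiff_mem_diffs ht hs)
    (sdiff_subset_sdiff hxt (Subset.refl s))

/-- A face `x` of the trace without its `r`-partner lying below an `r`-lifted member gives a
**tight** family `F ∪ {insert r x}`: every new difference is an old one. -/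
theorem tight_insert_of_subset_partr (hF : (F \\ F).card = F.card + 1)
    (hP : Tight (proj r F)) (hr : ({r} : Finset α) ∈ F) (hE : (∅ : Finset α) ∉ F)
    (hsing : ∀ a, a ≠ r → ({a} : Finset α) ∈ proj r F) {x : Finset α} (hxP : x ∈ proj r F)
    (hx1 : x ∉ partr r F) {t : Finset α} (ht : t ∈ partr r F) (hxt : x ⊆ t) :
    Tight (insert (insert r x) F) := by
  have hrx : r ∉ x := notMem_of_mem_proj' hxP
  have hnew : insert r x ∉ F := fun h => hx1 (mem_partr.2 ⟨hrx, h⟩)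
  have hX : diffsX r F = proj r F := diffsX_eq_proj_of_singleton_mem hP hr
  have hsub : insert (insert r x) F \\ insert (insert r x) F ⊆ F \\ F := by
    intro E hE'
    obtain ⟨A, hA, B, hB, rfl⟩ := Finset.mem_diffs.1 hE'
    rw [mem_insert] at hA hB
    rcases hA with rfl | hA <;> rcases hB with rfl | hB
    · simpa using sdiff_mem_diffs hr hr
    · by_cases hrB : r ∈ B
      · rw [insert_sdiff_of_mem x hrB]
        have h := mem_proj_of_subset hP hr hsing hxP (sdiff_subset (s := x) (t := B))
        rw [← hX, mem_diffsX_iff] at h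
        exact h.1
      · rw [insert_sdiff_of_notMem x hrB]
        exact (mem_diffsY_iff.1 (sdiff_mem_diffsY_of_subset_partr hF hP hr hE hsing ht hxt
          (mem_part0.2 ⟨hB, hrB⟩))).2
    · have hA' : A.erase r ∈ proj r F := mem_proj.2 ⟨A, hA, rfl⟩
      have h : A \ insert r x ∈ proj r F := by
        refine mem_proj_of_subset hP hr hsing hA' fun a ha => ?_
        rw [mem_sdiff, mem_insert] at ha
        exact mem_erase.2 ⟨fun h => ha.2 (Or.inl h), ha.1⟩
      rw [← hX, mem_diffsX_iff] at h
      exact h.1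
    · exact sdiff_mem_diffs hA hB
  have h1 := card_le_card hsub
  have h2 := card_le_card (diffs_subset (subset_insert (insert r x) F)
    (subset_insert (insert r x) F))
  have h3 := card_insert_of_notMem hnew
  unfold Tight
  omega

/-- With `F ∪ {insert r x}` tight (`x ∈ F₀`), `x` is the only member avoiding `r` without its
`r`-partner (Lemma B for the tight family: it is closed under adding `r`, the other alternative
putting `∅ = {r}.erase r` into `F`). -/
theorem eq_of_partnerless_of_tight_insert (hr : ({r} : Finset α) ∈ F) (hE : (∅ : Finset α) ∉ F)
    {x : Finset α} (hx0 : x ∈ part0 r F) (hT : Tight (insert (insert r x) F))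
    {p : Finset α} (hp0 : p ∈ part0 r F) (hp1 : p ∉ partr r F) : p = x := by
  have hrx : r ∉ x := (mem_part0.1 hx0).2
  have hrp : r ∉ p := (mem_part0.1 hp0).2
  have hrF' : ({r} : Finset α) ∈ insert (insert r x) F := mem_insert_of_mem hr
  have hxK : x ∈ partner r (insert (insert r x) F) :=
    mem_inter.2 ⟨mem_part0.2 ⟨mem_insert_of_mem (mem_part0.1 hx0).1, hrx⟩,
      mem_partr.2 ⟨hrx, mem_insert_self _ _⟩⟩
  have hdich := dichotomy_of_tight (tight_proj_and_partner (r := r) hT).2.1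
  rcases addable_or_deletable_of_partner_nonempty hT ⟨x, hxK⟩ hdich with hadd | hdel
  · have h := hadd p (mem_insert_of_mem (mem_part0.1 hp0).1) hrp
    rw [mem_insert] at h
    rcases h with h | h
    · have h' : (insert r p).erase r = (insert r x).erase r := by rw [h]
      rwa [erase_insert hrp, erase_insert hrx] at h'
    · exact absurd (mem_partr.2 ⟨hrp, h⟩) hp1
  · exfalso
    have h := hdel {r} hrF' (mem_singleton_self r)
    rw [erase_singleton, mem_insert] at h
    rcases h with h | h
    · exact insert_ne_empty r x h.symm
    · exact hE h

/-- At a cover `(k, insert b k)` with `k ∈ F₀` and `insert b k` an `r`-only member (a `(K, P₁)`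
witness when `k ∈ K`), the family `F ∪ {insert b k}` is **tight**: every new difference is an
old one (the differences `(insert r t) \ insert b k = insert r (t \ insert b k)` use `t \ k ∈ Y`
and Theorem (YD)). -/
theorem tight_insert_of_partner_cover (hF : (F \\ F).card = F.card + 1)
    (hP : Tight (proj r F)) (hr : ({r} : Finset α) ∈ F) (hE : (∅ : Finset α) ∉ F)
    (hsing : ∀ a, a ≠ r → ({a} : Finset α) ∈ proj r F) {k : Finset α} (hk0 : k ∈ part0 r F)
    {b : α} (hkb1 : insert b k ∈ partr r F) (hkb0 : insert b k ∉ part0 r F) :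
    Tight (insert (insert b k) F) := by
  have hrkb : r ∉ insert b k := (mem_partr.1 hkb1).1
  have hnew : insert b k ∉ F := fun h => hkb0 (mem_part0.2 ⟨h, hrkb⟩)
  have hX : diffsX r F = proj r F := diffsX_eq_proj_of_singleton_mem hP hr
  have hkbP : insert b k ∈ proj r F := by rw [proj_eq_union]; exact mem_union_right _ hkb1
  have hsub : insert (insert b k) F \\ insert (insert b k) F ⊆ F \\ F := by
    intro E hE'
    obtain ⟨A, hA, B, hB, rfl⟩ := Finset.mem_diffs.1 hE'
    rw [mem_insert] at hA hB
    rcases hA with rfl | hA <;> rcases hB with rfl | hB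
    · simpa using sdiff_mem_diffs hr hr
    · have h := mem_proj_of_subset hP hr hsing hkbP (sdiff_subset (s := insert b k) (t := B))
      rw [← hX, mem_diffsX_iff] at h
      exact h.1
    · by_cases hrA : r ∈ A
      · have hA1 : A.erase r ∈ partr r F :=
          mem_partr.2 ⟨notMem_erase r A, by rw [insert_erase hrA]; exact hA⟩
        have h1 : A.erase r \ k ∈ diffsY r F := sdiff_mem_diffs hA1 hk0
        have h2 : A.erase r \ insert b k ∈ diffsY r F :=
          mem_diffsY_of_subset hF hP hr hE hsing h1
            (sdiff_subset_sdiff (Subset.refl _) (subset_insert b k))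
        have e : A \ insert b k = insert r (A.erase r \ insert b k) := by
          rw [erase_sdiff_comm, insert_erase (mem_sdiff.2 ⟨hrA, hrkb⟩)]
        rw [e]
        exact (mem_diffsY_iff.1 h2).2
      · have hA' : A ∈ proj r F := by
          rw [proj_eq_union]; exact mem_union_left _ (mem_part0.2 ⟨hA, hrA⟩)
        have h := mem_proj_of_subset hP hr hsing hA' (sdiff_subset (s := A) (t := insert b k))
        rw [← hX, mem_diffsX_iff] at h
        exact h.1
    · exact sdiff_mem_diffs hA hB
  have h1 := card_le_card hsub
  have h2 := card_le_card (diffs_subset (subset_insert (insert b k) F)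
    (subset_insert (insert b k) F))
  have h3 := card_insert_of_notMem hnew
  unfold Tight
  omega

/-- With `F ∪ {insert b k}` tight for a partner member `k` and `r ∉ insert b k`, every member
avoiding `r` has its `r`-partner (Lemma B for the tight family). -/
theorem mem_partr_of_mem_part0_of_tight_insert (hr : ({r} : Finset α) ∈ F)
    (hE : (∅ : Finset α) ∉ F) {k : Finset α} (hk0 : k ∈ part0 r F) (hk1 : k ∈ partr r F)
    {b : α} (hkb1 : insert b k ∈ partr r F) (hT : Tight (insert (insert b k) F))
    {p : Finset α} (hp0 : p ∈ part0 r F) : p ∈ partr r F := by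
  have hrkb : r ∉ insert b k := (mem_partr.1 hkb1).1
  have hrF' : ({r} : Finset α) ∈ insert (insert b k) F := mem_insert_of_mem hr
  have hkK : k ∈ partner r (insert (insert b k) F) :=
    mem_inter.2 ⟨mem_part0.2 ⟨mem_insert_of_mem (mem_part0.1 hk0).1, (mem_part0.1 hk0).2⟩,
      mem_partr.2 ⟨(mem_part0.1 hk0).2, mem_insert_of_mem (mem_partr.1 hk1).2⟩⟩
  have hdich := dichotomy_of_tight (tight_proj_and_partner (r := r) hT).2.1
  rcases addable_or_deletable_of_partner_nonempty hT ⟨k, hkK⟩ hdich with hadd | hdel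
  · have h := hadd p (mem_insert_of_mem (mem_part0.1 hp0).1) (mem_part0.1 hp0).2
    rw [mem_insert] at h
    rcases h with h | h
    · exact absurd (h ▸ mem_insert_self r p) hrkb
    · exact mem_partr.2 ⟨(mem_part0.1 hp0).2, h⟩
  · exfalso
    have h := hdel {r} hrF' (mem_singleton_self r)
    rw [erase_singleton, mem_insert] at h
    rcases h with h | h
    · exact insert_ne_empty b k h.symm
    · exact hE h

/-- If `F₁` is not a down-set of the trace, some face without its `r`-partner has a cover that is
`r`-lifted (walk down from the offending `r`-lifted member). -/
theorem exists_cover_of_not_downSet (hP : Tight (proj r F)) (hr : ({r} : Finset α) ∈ F)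
    (hsing : ∀ a, a ≠ r → ({a} : Finset α) ∈ proj r F) {t : Finset α} (ht : t ∈ partr r F)
    {e : Finset α} (het : e ⊆ t) (he1 : e ∉ partr r F) :
    ∃ e' ∈ proj r F, e' ∉ partr r F ∧ ∃ b ∉ e', insert b e' ∈ partr r F := by
  induction t using Finset.strongInduction with
  | H t ih =>
    have hne : e ≠ t := fun h => he1 (h ▸ ht)
    obtain ⟨b, hbt, hbe⟩ := exists_of_ssubset (Finset.ssubset_iff_subset_ne.2 ⟨het, hne⟩)
    have htP : t ∈ proj r F := by rw [proj_eq_union]; exact mem_union_right _ ht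
    have ht'P : t.erase b ∈ proj r F := mem_proj_of_subset hP hr hsing htP (erase_subset b t)
    by_cases h1 : t.erase b ∈ partr r F
    · exact ih (t.erase b) (erase_ssubset hbt) h1 (subset_erase.2 ⟨het, hbe⟩)
    · exact ⟨t.erase b, ht'P, h1, b, notMem_erase b t, by rw [insert_erase hbt]; exact ht⟩

/-- If `F₀` is not an up-set of the trace, some member avoiding `r` has a cover that is a face
outside `F₀` (walk up from the offending member). -/
theorem exists_cover_of_not_upSet (hP : Tight (proj r F)) (hr : ({r} : Finset α) ∈ F)
    (hsing : ∀ a, a ≠ r → ({a} : Finset α) ∈ proj r F) {e : Finset α} (he : e ∈ proj r F)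
    (he0 : e ∉ part0 r F) {s : Finset α} (hs : s ∈ part0 r F) (hse : s ⊆ e) :
    ∃ s' ∈ part0 r F, ∃ b ∉ s', insert b s' ∈ proj r F ∧ insert b s' ∉ part0 r F := by
  obtain ⟨n, hn⟩ : ∃ n, (e \ s).card = n := ⟨_, rfl⟩
  induction n using Nat.strong_induction_on generalizing s with
  | h n ih =>
    have hne : s ≠ e := fun h => he0 (h ▸ hs)
    obtain ⟨b, hbe, hbs⟩ := exists_of_ssubset (Finset.ssubset_iff_subset_ne.2 ⟨hse, hne⟩)
    have hs'e : insert b s ⊆ e := insert_subset hbe hse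
    have hs'P : insert b s ∈ proj r F := mem_proj_of_subset hP hr hsing he hs'e
    by_cases h0 : insert b s ∈ part0 r F
    · have hlt : (e \ insert b s).card < n := by
        rw [← hn]
        apply card_lt_card
        rw [Finset.ssubset_iff_of_subset (sdiff_subset_sdiff (Subset.refl _) (subset_insert b s))]
        exact ⟨b, mem_sdiff.2 ⟨hbe, hbs⟩, fun h => (mem_sdiff.1 h).2 (mem_insert_self b s)⟩
      exact ih _ hlt h0 hs'e rfl
    · exact ⟨s, hs, b, hbs, hs'P, h0⟩

/-- **Theorem (MA).** For an excess-one family `F` with `{r} ∈ F`, `∅ ∉ F` and a tight trace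
containing every singleton: the labelling is monotone (`F₁` a down-set and `F₀` an up-set of the
trace), or every member avoiding `r` has its `r`-partner, or there is a member `x` avoiding `r`
without its `r`-partner such that `F ∪ {insert r x}` is tight, `x` is the only such member, and
`x` completes `F`. -/
theorem monotone_or_completed (hF : (F \\ F).card = F.card + 1) (hP : Tight (proj r F))
    (hr : ({r} : Finset α) ∈ F) (hE : (∅ : Finset α) ∉ F)
    (hsing : ∀ a, a ≠ r → ({a} : Finset α) ∈ proj r F) :
    ((∀ t ∈ partr r F, ∀ e ∈ proj r F, e ⊆ t → e ∈ partr r F) ∧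
        (∀ s ∈ part0 r F, ∀ e ∈ proj r F, s ⊆ e → e ∈ part0 r F)) ∨
      (∀ p ∈ part0 r F, p ∈ partr r F) ∨
      ∃ x ∈ part0 r F, x ∉ partr r F ∧ Tight (insert (insert r x) F) ∧
        (∀ p ∈ part0 r F, p ∉ partr r F → p = x) ∧ ∀ s ∈ part0 r F, x \ s ∈ diffsY r F := by
  by_cases hmono : (∀ t ∈ partr r F, ∀ e ∈ proj r F, e ⊆ t → e ∈ partr r F) ∧
      (∀ s ∈ part0 r F, ∀ e ∈ proj r F, s ⊆ e → e ∈ part0 r F)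
  · exact Or.inl hmono
  right
  have hcomp : ∀ x ∈ proj r F, x ∉ partr r F → ∀ b ∉ x, insert b x ∈ partr r F →
      ∃ x ∈ part0 r F, x ∉ partr r F ∧ Tight (insert (insert r x) F) ∧
        (∀ p ∈ part0 r F, p ∉ partr r F → p = x) ∧ ∀ s ∈ part0 r F, x \ s ∈ diffsY r F := by
    intro x hxP hx1 b _ hxb1
    have hx0 : x ∈ part0 r F := by
      rw [proj_eq_union, mem_union] at hxP; exact hxP.resolve_right hx1
    have hT := tight_insert_of_subset_partr hF hP hr hE hsing hxP hx1 hxb1 (subset_insert b x)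
    exact ⟨x, hx0, hx1, hT, fun p hp0 hp1 => eq_of_partnerless_of_tight_insert hr hE hx0 hT hp0 hp1,
      fun s hs => sdiff_mem_diffsY_of_subset_partr hF hP hr hE hsing hxb1 (subset_insert b x) hs⟩
  rw [not_and_or] at hmono
  rcases hmono with h | h
  · simp only [not_forall, exists_prop] at h
    obtain ⟨t, ht, e, _, het, he1⟩ := h
    obtain ⟨e', he'P, he'1, b, hbe', hbe'1⟩ := exists_cover_of_not_downSet hP hr hsing ht het he1
    exact Or.inr (hcomp e' he'P he'1 b hbe' hbe'1)
  · simp only [not_forall, exists_prop] at h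
    obtain ⟨s, hs, e, he, hse, he0⟩ := h
    obtain ⟨s', hs'0, b, hbs', hs'P, hs'0'⟩ := exists_cover_of_not_upSet hP hr hsing he he0 hs hse
    have hs'1 : insert b s' ∈ partr r F := by
      rw [proj_eq_union, mem_union] at hs'P; exact hs'P.resolve_left hs'0'
    by_cases hk : s' ∈ partr r F
    · left
      have hT := tight_insert_of_partner_cover hF hP hr hE hsing hs'0 hs'1 hs'0'
      exact fun p hp0 => mem_partr_of_mem_part0_of_tight_insert hr hE hs'0 hk hs'1 hT hp0
    · right
      have hs'P' : s' ∈ proj r F := by rw [proj_eq_union]; exact mem_union_left _ hs'0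
      exact hcomp s' hs'P' hk b hbs' hs'1

end MonotoneOrCompleted

end PercRepro.MSTight
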